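import Summits.Ventures.GridStability.Models.PolynomialiseRel
import Literature.MathematicalPhysics.PowerSystems.LyapunovFunctionFamilyRegionOfAttraction

/-!
# GridStability/Models/RelativeSwingLFF — model-1's relative classical model IS lit-6's Vu–Turitsyn «relativeSwing» system (bridge for the LFF-LMI lane)

Cell `gridfusion` (LADDER-GRIDFUSION G2 «LFF lane», lead 2026-08-27T01:19:25Z «PRODUCER SEQUENCING
(P1) LFF producer pilot on the WSCC9 uniform-λ variant with transfer conductances dropped … (P2) NE39SP»;
lit-6 01:18:42Z: «model-1: your PolynomialiseRel data (relative angles, uniform λ) is exactly this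
structure — a bridge "model-1 relative field = (relativeSwing …).field under the equilibrium data"»),
seat gridfusion-model-1, `plan/PARTITION.md` §0 row `Models/`. THREE COLUMNS: MODELLED column only
(lossless network-reduced classical model, uniform damping, one machine as angle reference:
MODEL-VALIDITY MV-2L + MV-λ); an exact identity between two typed vector fields; no certificate.

## Statement

Data: model-1's `RecastData n` (`n + 1` machines, reference index `0`; exact rational `M, E, G, B`
and equilibrium circle points), uniform damping ratio `λ` (`RecastData.toModelRel λ a′`: `D_i = λ M_i`,
`P_i = P′_i + M_i a′`, `P′ = P_e(δ*)`), LOSSLESS in the energy-function sense (`G_ij = 0` for `i ≠ j`;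
the self terms `E_i²G_ii` are constants and cancel) with reciprocal couplings (`B_ij = B_ji`).
lit-6's object (p481800): `LyapunovFunctionFamily.System.relativeSwing M' M_ref λ E w δ*`, the
Vu–Turitsyn bilinear form `ẋ = Ax − BF(Cx)` [cite: VuTuritsyn2016, §II eq. (3)] of the classical model in
angles relative to a reference machine under uniform damping [cite: SauerPai1998, §6.10 (6.238)–(6.241)].

* `lffE`, `lffW`, `lffδs`, `lffSystem` — the LINE PRESENTATION used: lines `κ = Fin (n+1) × Fin (n+1)`
  (ALL ordered machine pairs; diagonal and duplicate orientations carry zero / mirrored data and are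
  harmless), `E_{(i,j),m} = [i = m+1] − [j = m+1]` (line angle `θ_i − θ_j` in relative coordinates,
  `θ_0 ≡ 0`), weights `w_{(i,j)} = C_ij/2 = E_iE_jB_ij/2` (each unordered pair appears twice),
  equilibrium line angles `δ*_{(i,j)} = δ*_i − δ*_j`; `M'_m = M_{m+1}`, `M_ref = M_0`;
* `lffState δ* x = [u; ν]` — `u_m = (δ_{m+1} − δ_0) − (δ*_{m+1} − δ*_0)` (model-1's `RecastData.u`),
  `ν_m = ω_{m+1} − ω_0`;
* `lffSystem_nonlin` — on such states `F_{(i,j)} = sin(δ_i − δ_j) − sin(δ*_i − δ*_j)`;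
* `lffE_injective_aux` — `E` has the identity rows `(m+1, 0)`, so `ker E = 0` (observability input);
* `Pe_sub_Pe_eq_sum_lossless`, `sum_Pe_sub_Pe_eq_zero` — lossless bookkeeping:
  `P_ei(δ) − P_ei(δ*) = Σ_j C_ij (sin δ_ij − sin δ*_ij)` and these sum to zero over all machines;
* `hasDerivWithinAt_lffState` — **THE BRIDGE: along every solution `c` of model-1's
  `(d.toModelRel λ a′).IsSolutionOn c s` (any common acceleration `a′`), the relative state
  `t ↦ lffState δ* (c t)` solves lit-6's `(d.lffSystem λ δ*).field` within `s`.** Hence an LFF-LMI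
  certificate for `d.lffSystem λ δ*` (lit-6 `Certificate.well_subset_regionOfAttraction`, p479780) is an
  a-priori statement about every solution of the typed classical model — the -roa glue of the LFF lane,
  playing the role `hasDerivWithinAt_embedRel` plays for the SOS lane.

Instances: any `RecastData` whose off-diagonal `G` vanishes — the lead's P1 object «WSCC9 uniform-λ
variant with transfer conductances dropped» is `{WSCC9.postB_rel with G offdiag := 0}` (MODELLED MV-RD,
to be typed when P1 starts), NE39/KUNDUR2A lossless variants likewise; NE39.field / Kundur2A.csgPre
themselves keep `K^G` and are NOT instances (lead 01:19:25Z).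
-/

noncomputable section

open Real Finset Matrix
open Literature.MathematicalPhysics.PowerSystems

namespace Summit.Ventures.GridStability.Models

namespace RecastData

variable {n : ℕ} (d : RecastData n)

/-! ## The line presentation -/

/-- Line matrix in relative coordinates on ALL ordered machine pairs: row `(i, j)` reads the line angle
`θ_i − θ_j`, `θ_0 ≡ 0` (column `m` ↔ machine `m+1`). -/
def lffE (n : ℕ) : Matrix (Fin (n + 1) × Fin (n + 1)) (Fin n) ℝ :=
  fun k m => (if k.1 = m.succ then 1 else 0) - (if k.2 = m.succ then 1 else 0)

/-- Line weights `w_{(i,j)} = C_ij / 2 = E_iE_jB_ij / 2` (each unordered pair is listed twice). -/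
def lffW : Fin (n + 1) × Fin (n + 1) → ℝ := fun k => (d.Cc k.1 k.2 : ℝ) / 2

/-- Equilibrium line angles `δ*_{(i,j)} = δ*_i − δ*_j`. -/
def lffδs (δs : Fin (n + 1) → ℝ) : Fin (n + 1) × Fin (n + 1) → ℝ := fun k => δs k.1 - δs k.2

/-- **lit-6's Vu–Turitsyn system for model-1's relative classical model**: `relativeSwing` with
`M'_m = M_{m+1}`, `M_ref = M_0`, uniform damping ratio `λ`, the line presentation above.
MODELLED: MV-2L + MV-λ (lossless reduced network, uniform damping, machine `0` as angle reference). -/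
def lffSystem (lam : ℚ) (δs : Fin (n + 1) → ℝ) :
    LyapunovFunctionFamily.System (Fin n ⊕ Fin n) (Fin (n + 1) × Fin (n + 1)) :=
  LyapunovFunctionFamily.System.relativeSwing (fun m => (d.M m.succ : ℝ)) (d.M 0 : ℝ) (lam : ℝ)
    (lffE n) d.lffW (lffδs δs)

/-- The relative state `x = [u; ν]` of a classical state `(δ, ω)`: `u_m = RecastData.u δ* x (m+1)`,
`ν_m = ω_{m+1} − ω_0`. -/
def lffState (δs : Fin (n + 1) → ℝ) (x : ClassicalSwing.State (n + 1)) : Fin n ⊕ Fin n → ℝ :=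
  Sum.elim (fun m => u δs x m.succ) (fun m => x.2 m.succ - x.2 0)

/-! ## Generic facts about the second-order structure (field components) -/

section secondOrder

variable {μ κ : Type*} [Fintype μ] [DecidableEq μ] [Fintype κ]

/-- Angle rows of the field of a second-order structure: `ẋ₁ = x₂`. -/
theorem secondOrder_field_inl (Ad : Matrix μ μ ℝ) (Ba : Matrix μ κ ℝ) (E : Matrix κ μ ℝ)
    (δs : κ → ℝ) (x : μ ⊕ μ → ℝ) (m : μ) :
    (LyapunovFunctionFamily.System.secondOrder Ad Ba E δs).field x (Sum.inl m) = x (Sum.inr m) := by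
  have hA := congrFun (LyapunovFunctionFamily.System.secondOrder_A_mulVec_inl Ad Ba E δs x) m
  simp only [Function.comp_apply] at hA
  simp only [LyapunovFunctionFamily.System.field, Pi.sub_apply, hA]
  simp [LyapunovFunctionFamily.System.secondOrder, Matrix.fromRows_mulVec]

/-- Speed rows of the field of a second-order structure: `ẋ₂ = A_d x₂ − B_a F(Ex₁)`. -/
theorem secondOrder_field_inr (Ad : Matrix μ μ ℝ) (Ba : Matrix μ κ ℝ) (E : Matrix κ μ ℝ)
    (δs : κ → ℝ) (x : μ ⊕ μ → ℝ) (m : μ) :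
    (LyapunovFunctionFamily.System.secondOrder Ad Ba E δs).field x (Sum.inr m) =
      (Ad *ᵥ (x ∘ Sum.inr)) m -
        (Ba *ᵥ (LyapunovFunctionFamily.System.secondOrder Ad Ba E δs).nonlin x) m := by
  have hA : ((LyapunovFunctionFamily.System.secondOrder Ad Ba E δs).A *ᵥ x) (Sum.inr m) =
      (Ad *ᵥ (x ∘ Sum.inr)) m := by
    conv_lhs => rw [show (LyapunovFunctionFamily.System.secondOrder Ad Ba E δs).A =
        Matrix.fromBlocks 0 1 0 Ad from rfl, ← Sum.elim_comp_inl_inr x, Matrix.fromBlocks_mulVec]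
    simp
  have hB : ((LyapunovFunctionFamily.System.secondOrder Ad Ba E δs).B *ᵥ
      (LyapunovFunctionFamily.System.secondOrder Ad Ba E δs).nonlin x) (Sum.inr m) =
      (Ba *ᵥ (LyapunovFunctionFamily.System.secondOrder Ad Ba E δs).nonlin x) m := by
    rw [show (LyapunovFunctionFamily.System.secondOrder Ad Ba E δs).B = Matrix.fromRows 0 Ba from rfl,
      Matrix.fromRows_mulVec]
    rfl
  simp only [LyapunovFunctionFamily.System.field, Pi.sub_apply, hA, hB]

end secondOrder

/-! ## The nonlinearity and the line matrix on relative states -/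

/-- `(E v)_{(i,j)} = v⁺_i − v⁺_j` where `v⁺` extends `v : Fin n → ℝ` by `0` at the reference. -/
theorem lffE_mulVec (v : Fin n → ℝ) (k : Fin (n + 1) × Fin (n + 1)) :
    (lffE n *ᵥ v) k = Fin.cases (0 : ℝ) v k.1 - Fin.cases (0 : ℝ) v k.2 := by
  have key : ∀ i : Fin (n + 1), (∑ m : Fin n, (if i = m.succ then (1 : ℝ) else 0) * v m) =
      Fin.cases (0 : ℝ) v i := by
    intro i
    refine Fin.cases ?_ (fun m₀ => ?_) i
    · simp [eq_comm]
    · simp [Fin.succ_inj]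
  simp only [mulVec, dotProduct, lffE, sub_mul, Finset.sum_sub_distrib, key]

/-- On a relative state the line quantities are the angle differences:
`(C x)_{(i,j)} = u_i − u_j` (`u_0 = 0`). -/
theorem lffSystem_C_mulVec (lam : ℚ) (δs : Fin (n + 1) → ℝ) (x : ClassicalSwing.State (n + 1))
    (k : Fin (n + 1) × Fin (n + 1)) :
    ((d.lffSystem lam δs).C *ᵥ lffState δs x) k = u δs x k.1 - u δs x k.2 := by
  rw [lffSystem, LyapunovFunctionFamily.System.relativeSwing,
    LyapunovFunctionFamily.System.secondOrder_C_mulVec, lffE_mulVec]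
  have hcases : ∀ i : Fin (n + 1), Fin.cases (0 : ℝ) (lffState δs x ∘ Sum.inl) i = u δs x i := by
    intro i
    refine Fin.cases ?_ (fun m => ?_) i
    · simp
    · simp [lffState]
  rw [hcases, hcases]

/-- **The nonlinearity on relative states**: `F_{(i,j)} = sin(δ_i − δ_j) − sin(δ*_i − δ*_j)`. -/
theorem lffSystem_nonlin (lam : ℚ) (δs : Fin (n + 1) → ℝ) (x : ClassicalSwing.State (n + 1))
    (k : Fin (n + 1) × Fin (n + 1)) :
    (d.lffSystem lam δs).nonlin (lffState δs x) k =
      sin (x.1 k.1 - x.1 k.2) - sin (δs k.1 - δs k.2) := by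
  rw [LyapunovFunctionFamily.System.nonlin, lffSystem_C_mulVec]
  have hδ : (d.lffSystem lam δs).δs k = δs k.1 - δs k.2 := rfl
  rw [hδ, angle_split (δs := δs) x k.1 k.2]
  ring_nf

/-- `E` has the identity rows `(m+1, 0)`: `(E v)_{(m+1, 0)} = v_m`. Hence `ker E = 0`
(the observability input of lit-6's theorem; a rational left inverse is the selection of these rows). -/
theorem lffE_mulVec_succ_zero (v : Fin n → ℝ) (m : Fin n) :
    (lffE n *ᵥ v) (m.succ, 0) = v m := by
  rw [lffE_mulVec]; simp

/-- `ker E = 0`. -/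
theorem lffE_injective_aux (v : Fin n → ℝ) (hv : lffE n *ᵥ v = 0) : v = 0 := by
  funext m
  have := lffE_mulVec_succ_zero v m
  rw [hv] at this
  simpa using this.symm

/-! ## Lossless bookkeeping of the electrical powers -/

/-- Lossless + reciprocal data: `P_ei(δ) − P_ei(δ') = Σ_j C_ij (sin(δ_i − δ_j) − sin(δ'_i − δ'_j))`
(the transfer-conductance terms are absent, the self term cancels). -/
theorem Pe_sub_Pe_eq_sum_lossless (p : ClassicalSwing (n + 1))
    (hG : ∀ i j, i ≠ j → p.G i j = 0) (δ δ' : Fin (n + 1) → ℝ) (i : Fin (n + 1)) :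
    p.Pe δ i - p.Pe δ' i = ∑ j, p.Ccoef i j * (sin (δ i - δ j) - sin (δ' i - δ' j)) := by
  rw [p.Pe_eq_sum δ i, p.Pe_eq_sum δ' i, ← Finset.sum_sub_distrib]
  refine Finset.sum_congr rfl fun j _ => ?_
  by_cases hij : i = j
  · subst hij; simp [ClassicalSwing.Ccoef]
  · rw [hG i j hij]; simp only [ClassicalSwing.Ccoef]; ring

/-- Lossless + reciprocal data: the power mismatches sum to zero over ALL machines
(antisymmetry of `C_ij sin δ_ij`). -/
theorem sum_Pe_sub_Pe_eq_zero (p : ClassicalSwing (n + 1)) (hG : ∀ i j, i ≠ j → p.G i j = 0)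
    (hB : ∀ i j, p.B i j = p.B j i) (δ δ' : Fin (n + 1) → ℝ) :
    ∑ i, (p.Pe δ i - p.Pe δ' i) = 0 := by
  simp only [Pe_sub_Pe_eq_sum_lossless p hG]
  have h : ∑ i, ∑ j, p.Ccoef i j * (sin (δ i - δ j) - sin (δ' i - δ' j)) =
      -∑ i, ∑ j, p.Ccoef i j * (sin (δ i - δ j) - sin (δ' i - δ' j)) := by
    conv_lhs => rw [Finset.sum_comm]
    rw [← Finset.sum_neg_distrib]
    refine Finset.sum_congr rfl fun i _ => ?_
    rw [← Finset.sum_neg_distrib]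
    refine Finset.sum_congr rfl fun j _ => ?_
    have hC : p.Ccoef j i = p.Ccoef i j := by simp only [ClassicalSwing.Ccoef, hB j i]; ring
    rw [hC, ← neg_sub (δ i) (δ j), ← neg_sub (δ' i) (δ' j), sin_neg, sin_neg]
    ring
  linarith

/-- The weighted line sum seen from machine `m+1`:
`(Eᵀ (w·F))_m = P_e,m+1(δ) − P_e,m+1(δ*)` for the model `toModelRel λ a′` (lossless, reciprocal). -/
theorem lffE_transpose_mulVec (lam : ℚ) (a : ℝ) (hG : ∀ i j, i ≠ j → d.G i j = 0)
    (hB : ∀ i j, d.B i j = d.B j i) (δs : Fin (n + 1) → ℝ) (x : ClassicalSwing.State (n + 1))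
    (m : Fin n) :
    ((lffE n)ᵀ *ᵥ fun k => d.lffW k * (d.lffSystem lam δs).nonlin (lffState δs x) k) m =
      (d.toModelRel lam a).Pe x.1 m.succ - (d.toModelRel lam a).Pe δs m.succ := by
  have hG' : ∀ i j, i ≠ j → (d.toModelRel lam a).G i j = 0 := by
    intro i j hij; simp [toModelRel, hG i j hij]
  rw [Pe_sub_Pe_eq_sum_lossless _ hG']
  simp only [mulVec, dotProduct, transpose_apply, lffE, lffSystem_nonlin, lffW, Fintype.sum_prod_type,
    sub_mul, Finset.sum_sub_distrib, ite_mul, one_mul, zero_mul, Finset.sum_ite_eq',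
    Finset.mem_univ, if_true]
  -- Σ_j G(m+1, j) − Σ_i G(i, m+1) with G(i, m+1) = −G(m+1, i)
  rw [Finset.sum_comm]
  simp only [Finset.sum_ite_eq', Finset.mem_univ, if_true]
  have hanti : ∀ i, (d.Cc i m.succ : ℝ) / 2 * (sin (x.1 i - x.1 m.succ) - sin (δs i - δs m.succ)) =
      -((d.Cc m.succ i : ℝ) / 2 * (sin (x.1 m.succ - x.1 i) - sin (δs m.succ - δs i))) := by
    intro i
    have hC : d.Cc i m.succ = d.Cc m.succ i := by simp only [Cc, hB i m.succ]; ring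
    rw [hC, ← neg_sub (x.1 m.succ) (x.1 i), ← neg_sub (δs m.succ) (δs i), sin_neg, sin_neg]
    ring
  simp only [hanti, Finset.sum_neg_distrib, sub_neg_eq_add]
  rw [← Finset.sum_add_distrib]
  refine Finset.sum_congr rfl fun j _ => ?_
  simp only [ClassicalSwing.Ccoef, toModelRel, Cc, Rat.cast_mul]
  ring

/-! ## The field of `lffSystem` on relative states -/

/-- Angle rows: `u̇_m = ν_m`. -/
theorem lffSystem_field_inl (lam : ℚ) (δs : Fin (n + 1) → ℝ) (x : ClassicalSwing.State (n + 1))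
    (m : Fin n) : (d.lffSystem lam δs).field (lffState δs x) (Sum.inl m) = x.2 m.succ - x.2 0 := by
  rw [lffSystem, LyapunovFunctionFamily.System.relativeSwing, secondOrder_field_inl]
  rfl

/-- Speed rows: `ν̇_m = −λ ν_m − (P_e,m+1(δ) − P_e,m+1(δ*))/M_{m+1} − (1/M_0) Σ_{m'} (P_e,m'+1(δ) − P_e,m'+1(δ*))`
(the last sum `= −(P_e,0(δ) − P_e,0(δ*))/M_0` by losslessness). -/
theorem lffSystem_field_inr (lam : ℚ) (a : ℝ) (hG : ∀ i j, i ≠ j → d.G i j = 0)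
    (hB : ∀ i j, d.B i j = d.B j i) (δs : Fin (n + 1) → ℝ) (x : ClassicalSwing.State (n + 1))
    (m : Fin n) :
    (d.lffSystem lam δs).field (lffState δs x) (Sum.inr m) =
      -(lam : ℝ) * (x.2 m.succ - x.2 0)
        - ((d.toModelRel lam a).Pe x.1 m.succ - (d.toModelRel lam a).Pe δs m.succ) / (d.M m.succ : ℝ)
        - (∑ m' : Fin n, ((d.toModelRel lam a).Pe x.1 m'.succ - (d.toModelRel lam a).Pe δs m'.succ))
            / (d.M 0 : ℝ) := by
  rw [lffSystem, LyapunovFunctionFamily.System.relativeSwing, secondOrder_field_inr,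
    ← LyapunovFunctionFamily.System.relativeSwing]
  have hAd : ((-((lam : ℝ) • (1 : Matrix (Fin n) (Fin n) ℝ))) *ᵥ (lffState δs x ∘ Sum.inr)) m =
      -(lam : ℝ) * (x.2 m.succ - x.2 0) := by
    simp [mulVec, dotProduct, Matrix.one_apply, lffState, Finset.sum_ite_eq]
  -- the `B_a F` term through `Eᵀ (w · F)`
  set G : Fin (n + 1) × Fin (n + 1) → ℝ := fun k =>
    d.lffW k * (d.lffSystem lam δs).nonlin (lffState δs x) k with hGdef
  have hWF : Matrix.diagonal d.lffW *ᵥ (d.lffSystem lam δs).nonlin (lffState δs x) = G := by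
    funext k; simp [hGdef, mulVec_diagonal]
  have hEt : ∀ m', ((lffE n)ᵀ *ᵥ G) m' =
      (d.toModelRel lam a).Pe x.1 m'.succ - (d.toModelRel lam a).Pe δs m'.succ :=
    fun m' => d.lffE_transpose_mulVec lam a hG hB δs x m'
  have hBa : (((Matrix.diagonal fun i : Fin n => 1 / (d.M i.succ : ℝ)) +
        Matrix.of fun _ _ : Fin n => 1 / (d.M 0 : ℝ)) * (lffE n)ᵀ * Matrix.diagonal d.lffW) *ᵥ
        (d.lffSystem lam δs).nonlin (lffState δs x) =
      fun m => ((lffE n)ᵀ *ᵥ G) m / (d.M m.succ : ℝ) + (∑ m', ((lffE n)ᵀ *ᵥ G) m') / (d.M 0 : ℝ) := by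
    rw [← mulVec_mulVec, ← mulVec_mulVec, hWF]
    funext m
    simp only [add_mulVec, Pi.add_apply, mulVec_diagonal]
    congr 1
    · ring
    · simp only [mulVec, dotProduct, Matrix.of_apply]
      rw [Finset.sum_div]
      exact Finset.sum_congr rfl fun i _ => by ring
  have hnonlin : (LyapunovFunctionFamily.System.relativeSwing (fun m => (d.M m.succ : ℝ)) (d.M 0 : ℝ)
      (lam : ℝ) (lffE n) d.lffW (lffδs δs)).nonlin (lffState δs x) =
      (d.lffSystem lam δs).nonlin (lffState δs x) := rfl
  rw [hnonlin, hAd, hBa]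
  simp only [hEt]
  ring

/-! ## The bridge: classical solutions solve the LFF system -/

/-- Under `EqData` the exact equilibrium powers are the powers at `δ*`: `P′_i = P_e,i(δ*)` (cast). -/
theorem Pprime_cast (lam : ℚ) (a : ℝ) {δs : Fin (n + 1) → ℝ} (h : d.EqData δs) (i : Fin (n + 1)) :
    (d.Pprime i : ℝ) = (d.toModelRel lam a).Pe δs i := by
  rw [d.Pprime_eq, ClassicalSwing.Pe, Rat.cast_add, Rat.cast_sum]
  congr 1
  · simp [toModelRel]
  · refine Finset.sum_congr rfl fun j _ => ?_
    simp only [PeTermEq, Rat.cast_add, Rat.cast_mul, d.sd_cast h, d.cd_cast h, ClassicalSwing.Ccoef,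
      ClassicalSwing.Dcoef, toModelRel, Cc, Dc]

/-- **THE BRIDGE (chain rule).** MODELLED: lossless reduced classical model, uniform damping ratio
`λ`, reciprocal couplings, reference machine `0`, A1 equilibrium data `δ*`. Along EVERY solution `c`
of model-1's `(d.toModelRel λ a′).IsSolutionOn c s`, the relative state `t ↦ lffState δ* (c t)`
satisfies `ẋ = (d.lffSystem λ δ*).field x` within `s` — so lit-6's LFF-LMI theorems
(`Certificate.well_subset_regionOfAttraction…`, p479780) for `d.lffSystem λ δ*` are a-priori
statements about all such solutions. -/
theorem hasDerivWithinAt_lffState (lam : ℚ) (a : ℝ) (hG : ∀ i j, i ≠ j → d.G i j = 0)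
    (hB : ∀ i j, d.B i j = d.B j i) {δs : Fin (n + 1) → ℝ} (h : d.EqData δs)
    (hM : ∀ i, d.M i ≠ 0) {c : ℝ → ClassicalSwing.State (n + 1)} {s : Set ℝ}
    (hc : (d.toModelRel lam a).IsSolutionOn c s) {t : ℝ} (ht : t ∈ s) :
    HasDerivWithinAt (fun τ => lffState δs (c τ))
      ((d.lffSystem lam δs).field (lffState δs (c t))) s t := by
  set p := d.toModelRel lam a with hp
  -- component derivatives of the classical solution
  have hδ : ∀ i, HasDerivWithinAt (fun τ => (c τ).1 i) ((c t).2 i) s t := by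
    intro i
    have h1 := ((hc t ht).hasFDerivWithinAt.fst).hasDerivWithinAt
    simpa [ClassicalSwing.field] using (hasDerivWithinAt_pi.1 h1) i
  have hω : ∀ i, HasDerivWithinAt (fun τ => (c τ).2 i)
      ((p.P i - p.Pe (c t).1 i - p.D i * (c t).2 i) / p.M i) s t := by
    intro i
    have h2 := ((hc t ht).hasFDerivWithinAt.snd).hasDerivWithinAt
    simpa [ClassicalSwing.field] using (hasDerivWithinAt_pi.1 h2) i
  have hMr : ∀ i, (p.M i : ℝ) ≠ 0 := fun i => by
    simp only [hp, toModelRel, ne_eq, Rat.cast_eq_zero]; exact hM i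
  -- the swing right-hand side rewritten with `P′ = P_e(δ*)`, `D = λ M`
  have hω' : ∀ i, HasDerivWithinAt (fun τ => (c τ).2 i)
      (a - (lam : ℝ) * (c t).2 i - (p.Pe (c t).1 i - p.Pe δs i) / p.M i) s t := by
    intro i
    refine (hω i).congr_deriv ?_
    have hP : p.P i = p.Pe δs i + p.M i * a := by
      show (d.Pprime i : ℝ) + d.M i * a = _; rw [d.Pprime_cast lam a h i]; rfl
    have hD : p.D i = (lam : ℝ) * p.M i := rfl
    rw [hP, hD]
    field_simp [hMr i]
    ring
  apply hasDerivWithinAt_pi.2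
  rintro (m | m)
  · -- angle rows
    rw [lffSystem_field_inl]
    have := ((hδ m.succ).sub (hδ 0)).sub_const (δs m.succ - δs 0)
    simpa [lffState, u] using this
  · -- speed rows
    rw [d.lffSystem_field_inr lam a hG hB δs (c t) m]
    have hsum := sum_Pe_sub_Pe_eq_zero p (fun i j hij => by simp [hp, toModelRel, hG i j hij])
      (fun i j => by simp [hp, toModelRel, hB i j]) (c t).1 δs
    rw [Fin.sum_univ_succ] at hsum
    have key := (hω' m.succ).sub (hω' 0)
    refine key.congr_deriv ?_
    have hM0 : (p.M 0 : ℝ) = (d.M 0 : ℝ) := rfl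
    have hMs : (p.M m.succ : ℝ) = (d.M m.succ : ℝ) := rfl
    rw [hM0, hMs]
    have hsum' : ∑ m' : Fin n, (p.Pe (c t).1 m'.succ - p.Pe δs m'.succ) =
        -(p.Pe (c t).1 0 - p.Pe δs 0) := by linarith
    rw [hsum']
    have hM0' : (d.M 0 : ℝ) ≠ 0 := by exact_mod_cast hM 0
    field_simp
    ring

end RecastData

end Summit.Ventures.GridStability.Models

end
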